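import Summits.QuantumFields.BalabanUV.Beta.GAN24.LatticeFreeze

/-!
# `BalabanUV.Beta.GAN24.SlotMomentParity` — binder row G-an2-4 ∕ (CONV-C), W-slot CT-W, route «WC-TL» ∕ (Q-R) «QR-LL», the (S) row of RULING R-gan24p1-g27-1
# (journal [GAN24P1-G27-ONLINE]): **ZERO MASS + INVARIANCE UNDER ONE SLOT INVOLUTION ⇒ ALL FIRST SLOT-MOMENTS VANISH** — the parity half of the σ-letter moment
# identities (M0)∕(Π) in exactly the hypothesis shape of leaf-01's (LT-3) consumer `LayerPushMoments.abs_tsum_mul_le_of_moments` (row owner `b2b-balaban-gan24-p1`, gen 27)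

NOT IN PRINT; OUR BOOKKEEPING ([folklore] one change of variables in a `tsum` ∕ finite sum; 0 cited facts, 0 `def`, 0 `def … : Prop`, 0 sorry).  HONEST FRAMING (cell
contract, verbatim): «discharging `BetaPertH` makes Bałaban's UV stability UNCONDITIONAL — a real constructive-QFT result; it is NOT the continuum limit and NOT the Clay
problem.»  HONEST DEPENDENCY (verbatim): «continuum YM on T⁴ ⇐ BetaPertH ∧ nine spine estimates (0/9 proved); BetaPertH ⇐ (D1) ∧ (D4) ∧ CAP+tail; G-an2-4 gates asym, D1
and NE2/3/4.»

WHY (located by the owner's ENGINE E19, kit j154879, SDF-1 at D = 2, Bc = 3, level 0 → 1; numbers are float64 DIAGNOSTICS and decide nothing here): the per-slot charge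
profile `e = (ν, y′) ↦ q(Ψ_j(y; e))` of the kernel-law inhomogeneity has zero mass (M0) and zero first slot-moments (Π) about its label `y` (E15∕E19: `|M0| ≤ 6e-12`,
`|dipole| ≤ 1.1e-11` against per-slot charges `546`), is NOT covariant under the single block-centre AXIS reflections (relative defects O(1)), but IS invariant under the
POINT INVERSION through the label composed with the unit shift of the slot bond, `y′ ↦ 2•y − y′ − e_ν` (the positive `ν`-bond at `y′`, inverted through `y`, is the
positive `ν`-bond at `2y − y′ − e_ν` traversed backwards) — read off the printed profile tables to the printed digits.  THIS FILE is the half of (S) that such an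
invariance buys, stated abstractly and then on the slot lattice `ℤ^D`:
* §1 `sum_mul_eq_zero_of_involutive` ∕ **`tsum_mul_eq_zero_of_involutive`**: for ANY involution-like bijection `σ` with `Z ∘ σ = Z` and an AFFINE-ODD weight
  `w (σ e) = −w e − κ`, zero mass `Σ Z = 0` forces `Σ w·Z = 0` (the substitution `e ↦ σ e` gives `S = −S − κ·0`); `tsum_eq_zero_of_anti_involutive`: if instead
  `Z ∘ σ = −Z` the MASS vanishes (and the first moment is unconstrained).
* §2 **`tsum_slotMoment_eq_zero_of_slotInv`**: on `Site D = ℤ^D`, a profile `Z` localised at `y` (`|Z e| ≤ B·e^{−δ‖e−y‖₁}`), invariant under `e ↦ 2•y − e_ν − e`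
  and of zero mass has `∑' e, (e − y)_λ · Z e = 0` for EVERY direction `λ` (one involution, all `D` moments: `κ = [λ = ν]`); §3 **`moments_of_slotInv`** bundles
  (M0) ∧ (Π) in the verbatim hypothesis shape `hM0 ∕ hP1` of `LayerPushMoments.abs_tsum_mul_le_of_moments`; `tsum_slotMoment_recentre` (zero mass ⇒ the first moment is
  centre-free, so per-label moments give super-block moments) and `hasSum_moments_sum` (additivity over pieces ∕ labels) are the two bookkeeping steps to the consumer.
What this file does NOT do: it does not prove the invariance `Z ∘ σ = Z` for any σ-letter of the typed towers (that is the structural half of the (S) row — the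
point-inversion covariance of the dressed kernels, tables and block generators, cf. the axis-reflection family `AxialDressingRootedBmKernel.refK_coDressKBmAt_KInvStep`,
`ResolventReflection.refK_KInvStep`, Literature `PolarizationSign.AxisReflectionCovariant`), nor (M0) (W-Z0 in the owner's R11); both stay DISPLAYED hypotheses.
Discharges NOTHING of (S) ∕ (Q-R) ∕ (LT) ∕ (Q-L) ∕ (C) ∕ «T2Shape» ∕ «T2Drift» ∕ (hW, hWall) by itself; NEVER «G-an2-4 closed» as (CONV-C); NOT D1, NOT `BetaPertH`, NOT continuum,
NOT Clay.  2026-08-22; no existing file touched.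
-/

noncomputable section

open Finset
open scoped BigOperators
open Literature.MathematicalPhysics.QuantumFieldTheory
open Literature.MathematicalPhysics.QuantumFieldTheory.Balaban1983to89
open Literature.MathematicalPhysics.QuantumFieldTheory.Balaban1983to89.Beta
open B12Sec2to5 (l1 l1_nonneg abs_coord_le_l1)
open ExpKernelCalculus (Site summable_exp_shift')
open Summit.QuantumFields.BalabanUV.Beta.GAN24.LatticeFreeze (mul_exp_neg_le)

namespace Summit.QuantumFields.BalabanUV.Beta.GAN24.SlotMomentParity

/-! ## §1 Abstract: an involution fixing the profile and affine-odd on the weight kills the weighted sum, given zero mass -/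

/-- [folklore] **FINITE FORM.**  If a bijection `σ` of a finite index set fixes the profile, `Z (σ e) = Z e`, and acts affinely-oddly on the weight, `w (σ e) = −w e − κ`,
then zero mass `Σ Z = 0` forces `Σ w·Z = 0`: substituting `e ↦ σ e` gives `S = −S − κ·Σ Z`. -/
theorem sum_mul_eq_zero_of_involutive {ι : Type*} [Fintype ι] (σ : ι ≃ ι) {Z w : ι → ℝ} {κ : ℝ}
    (hZ : ∀ e, Z (σ e) = Z e) (hw : ∀ e, w (σ e) = -w e - κ) (hM0 : ∑ e, Z e = 0) :
    ∑ e, w e * Z e = 0 := by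
  have h1 : ∑ e, w (σ e) * Z (σ e) = ∑ e, w e * Z e := Equiv.sum_comp σ (fun e => w e * Z e)
  have h2 : ∑ e, w (σ e) * Z (σ e) = ∑ e, (-(w e * Z e) - κ * Z e) :=
    Finset.sum_congr rfl fun e _ => by rw [hZ, hw]; ring
  rw [h2, Finset.sum_sub_distrib, Finset.sum_neg_distrib, ← Finset.mul_sum, hM0, mul_zero, sub_zero] at h1
  linarith

/-- [folklore] **`tsum` FORM** (the one the lattice instance uses).  Same statement for a summable profile on an arbitrary index type: `Z ∘ σ = Z`, `w ∘ σ = −w − κ`,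
`Σ' Z = 0`, `w·Z` summable ⇒ `Σ' w·Z = 0`. -/
theorem tsum_mul_eq_zero_of_involutive {ι : Type*} (σ : ι ≃ ι) {Z w : ι → ℝ} {κ : ℝ}
    (hZ : ∀ e, Z (σ e) = Z e) (hw : ∀ e, w (σ e) = -w e - κ)
    (hZs : Summable Z) (hwZ : Summable fun e => w e * Z e) (hM0 : ∑' e, Z e = 0) :
    ∑' e, w e * Z e = 0 := by
  have h1 : ∑' e, w (σ e) * Z (σ e) = ∑' e, w e * Z e := Equiv.tsum_eq σ (fun e => w e * Z e)
  have h2 : (fun e => w (σ e) * Z (σ e)) = fun e => -(w e * Z e) - κ * Z e := by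
    funext e; rw [hZ, hw]; ring
  rw [h2, hwZ.neg.tsum_sub (hZs.mul_left κ), tsum_neg, tsum_mul_left, hM0, mul_zero, sub_zero] at h1
  linarith

/-- [folklore] The ANTI-invariant case: `Z (σ e) = −Z e` forces the MASS to vanish, `Σ' Z = 0` (and says nothing about first moments). -/
theorem tsum_eq_zero_of_anti_involutive {ι : Type*} (σ : ι ≃ ι) {Z : ι → ℝ} (hZ : ∀ e, Z (σ e) = -Z e) :
    ∑' e, Z e = 0 := by
  have h1 : ∑' e, Z (σ e) = ∑' e, Z e := Equiv.tsum_eq σ Z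
  have h2 : (fun e => Z (σ e)) = fun e => -Z e := funext hZ
  rw [h2, tsum_neg] at h1
  linarith

/-! ## §2 The slot lattice: point inversion through the label composed with the unit slot shift -/

variable {D : ℕ}

/-- [folklore] The weight `(e − y)_λ` is affine-odd under the slot involution `e ↦ 2•y − e_ν − e`:
`((2•y − e_ν − e) − y)_λ = −(e − y)_λ − [λ = ν]`. -/
theorem coord_slotInv (y e : Site D) (ν lam : Fin D) :
    (((((2 : ℕ) • y - (Pi.single ν (1 : ℤ) : Site D) - e) - y) lam : ℤ) : ℝ) = -(((e - y) lam : ℤ) : ℝ) - (if lam = ν then 1 else 0) := by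
  have h : (((2 : ℕ) • y - (Pi.single ν (1 : ℤ) : Site D) - e) - y) lam = -((e - y) lam) - (Pi.single ν (1 : ℤ) : Site D) lam := by
    simp only [Pi.sub_apply, Pi.smul_apply]; ring
  rw [h, Pi.single_apply]
  push_cast
  split_ifs <;> simp

/-- [folklore] Summability of the first slot-moment of a profile localised at `y`: `|Z e| ≤ B·e^{−δ‖e−y‖₁}` ⇒ `e ↦ (e − y)_λ·Z e` summable
(`|(e−y)_λ| ≤ ‖e−y‖₁`, `t·e^{−δt} ≤ (2∕δ)·e^{−(δ∕2)t}`; the bookkeeping of `LayerPushMoments.abs_tsum_mul_le_of_moments`, isolated). -/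
theorem summable_slotMoment_of_envelope {Z : Site D → ℝ} {y : Site D} {B δ : ℝ} (hδ : 0 < δ)
    (hZb : ∀ e, |Z e| ≤ B * Real.exp (-δ * l1 (e - y))) (lam : Fin D) :
    Summable fun e : Site D => (((e - y) lam : ℤ) : ℝ) * Z e := by
  have hB : 0 ≤ B := by
    have h0 := hZb y
    rw [sub_self, show l1 (0 : Site D) = 0 by simp [l1], mul_zero, Real.exp_zero, mul_one] at h0
    exact (abs_nonneg _).trans h0
  refine Summable.of_norm_bounded ((summable_exp_shift' (half_pos hδ) y).mul_left (B * (2 / δ))) fun e => ?_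
  rw [Real.norm_eq_abs, abs_mul]
  have hc : |(((e - y) lam : ℤ) : ℝ)| ≤ l1 (e - y) := abs_coord_le_l1 (e - y) lam
  have hm := mul_exp_neg_le hδ (l1 (e - y))
  calc |(((e - y) lam : ℤ) : ℝ)| * |Z e| ≤ l1 (e - y) * (B * Real.exp (-δ * l1 (e - y))) :=
        mul_le_mul hc (hZb e) (abs_nonneg _) (l1_nonneg _)
    _ = B * (l1 (e - y) * Real.exp (-δ * l1 (e - y))) := by ring
    _ ≤ B * (2 / δ * Real.exp (-(δ / 2) * l1 (e - y))) := mul_le_mul_of_nonneg_left hm hB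
    _ = B * (2 / δ) * Real.exp (-(δ / 2) * l1 (e - y)) := by ring

/-- [folklore] Summability of a profile under an exponential envelope. -/
theorem summable_of_envelope {Z : Site D → ℝ} {y : Site D} {B δ : ℝ} (hδ : 0 < δ)
    (hZb : ∀ e, |Z e| ≤ B * Real.exp (-δ * l1 (e - y))) : Summable Z :=
  Summable.of_norm_bounded ((summable_exp_shift' hδ y).mul_left B) fun e => by rw [Real.norm_eq_abs]; exact hZb e

/-- NOT IN PRINT; OUR BOOKKEEPING (the parity half of the (S) row of R-gan24p1-g27-1).  **ONE SLOT INVOLUTION, ALL FIRST MOMENTS.**  A profile `Z` on the slot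
lattice `ℤ^D`, exponentially localised at its label `y`, INVARIANT under the point inversion through `y` composed with the unit shift of the slot direction `ν`
(`Z (2•y − e_ν − e) = Z e`) and of ZERO MASS (`Σ' Z = 0`), has vanishing first slot-moments about `y` in EVERY direction `λ`:
`Σ'_e (e − y)_λ · Z e = 0`.  (Transverse directions `λ ≠ ν` pair off exactly; the longitudinal one `λ = ν` leaves `−½·(mass) = 0`.) -/
theorem tsum_slotMoment_eq_zero_of_slotInv {Z : Site D → ℝ} (y : Site D) (ν : Fin D) {B δ : ℝ} (hδ : 0 < δ)
    (hZb : ∀ e, |Z e| ≤ B * Real.exp (-δ * l1 (e - y)))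
    (hinv : ∀ e, Z ((2 : ℕ) • y - (Pi.single ν (1 : ℤ) : Site D) - e) = Z e) (hM0 : ∑' e, Z e = 0) (lam : Fin D) :
    ∑' e : Site D, (((e - y) lam : ℤ) : ℝ) * Z e = 0 :=
  tsum_mul_eq_zero_of_involutive (Equiv.subLeft ((2 : ℕ) • y - (Pi.single ν (1 : ℤ) : Site D))) (κ := if lam = ν then 1 else 0)
    (fun e => by rw [Equiv.subLeft_apply]; exact hinv e)
    (fun e => by rw [Equiv.subLeft_apply]; exact coord_slotInv y e ν lam)
    (summable_of_envelope hδ hZb) (summable_slotMoment_of_envelope hδ hZb lam) hM0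

/-! ## §3 The bundle in the (LT-3) consumer's hypothesis shape -/

/-- NOT IN PRINT; OUR BOOKKEEPING.  **(M0) ∧ (Π) FROM ZERO MASS ∧ SLOT-INVERSION INVARIANCE**, in the verbatim shape of the displayed hypotheses `hM0 ∕ hP1` of
`LayerPushMoments.abs_tsum_mul_le_of_moments` (leaf-01 g63, (LT-3)): for such a profile the frozen term of the layer push integrates the constant AND the linear Taylor
terms to zero.  The two inputs stay displayed: (M0) is W-Z0 of the owner's R11; the invariance is the structural (point-inversion covariance) half of the (S) row. -/
theorem moments_of_slotInv {Z : Site D → ℝ} (y : Site D) (ν : Fin D) {B δ : ℝ} (hδ : 0 < δ)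
    (hZb : ∀ e, |Z e| ≤ B * Real.exp (-δ * l1 (e - y)))
    (hinv : ∀ e, Z ((2 : ℕ) • y - (Pi.single ν (1 : ℤ) : Site D) - e) = Z e) (hM0 : ∑' e, Z e = 0) :
    (∑' e, Z e = 0) ∧ ∀ i : Fin D, ∑' e : Site D, (((e - y) i : ℤ) : ℝ) * Z e = 0 :=
  ⟨hM0, fun i => tsum_slotMoment_eq_zero_of_slotInv y ν hδ hZb hinv hM0 i⟩

/-- [folklore] **RECENTRING A FIRST MOMENT UNDER ZERO MASS**: if `Σ' Z = 0` then the first `λ`-moment does not depend on the centre,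
`Σ' (e − c′)_λ·Z e = Σ' (e − c)_λ·Z e` — so per-label (M0) ∧ (Π) about the label give (Π) about the SUPER-BLOCK centre for the block sum of labels (leaf-01 g64
W-leaf01-g64-1: the (LT-3) consumer at level `j+1` reads the plain profile of the level-`(j+1)` letter, a block sum over the level-`j` labels). -/
theorem tsum_slotMoment_recentre {Z : Site D → ℝ} (c c' : Site D) (lam : Fin D)
    (hZs : Summable Z) (hm : Summable fun e => (((e - c) lam : ℤ) : ℝ) * Z e) (hM0 : ∑' e, Z e = 0) :
    ∑' e : Site D, (((e - c') lam : ℤ) : ℝ) * Z e = ∑' e : Site D, (((e - c) lam : ℤ) : ℝ) * Z e := by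
  have h : (fun e : Site D => (((e - c') lam : ℤ) : ℝ) * Z e) = fun e => (((e - c) lam : ℤ) : ℝ) * Z e + (((c - c') lam : ℤ) : ℝ) * Z e := by
    funext e
    have : (((e - c') lam : ℤ) : ℝ) = (((e - c) lam : ℤ) : ℝ) + (((c - c') lam : ℤ) : ℝ) := by
      push_cast [Pi.sub_apply]; ring
    rw [this]; ring
  rw [h, hm.tsum_add (hZs.mul_left _), tsum_mul_left, hM0, mul_zero, add_zero]

/-- [folklore] **ADDITIVITY OF THE TWO MOMENT FUNCTIONALS OVER PIECES** (the owner's W4 ask to p2 g38, here for plain profiles): if each of finitely many profiles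
`Z p` has a summable mass with value `m p` and a summable first `λ`-moment with value `μ p`, the summed profile has mass `Σ m` and moment `Σ μ` — so (M0)∕(Π) for
`Ψ = τ + β + α + γ` follow from the four pieces' values adding to zero, no piece needing them separately. -/
theorem hasSum_moments_sum {ι : Type*} (s : Finset ι) {Z : ι → Site D → ℝ} {w : Site D → ℝ} {m μ : ι → ℝ}
    (hm : ∀ p ∈ s, HasSum (Z p) (m p)) (hμ : ∀ p ∈ s, HasSum (fun e => w e * Z p e) (μ p)) :
    HasSum (fun e => ∑ p ∈ s, Z p e) (∑ p ∈ s, m p) ∧ HasSum (fun e => w e * ∑ p ∈ s, Z p e) (∑ p ∈ s, μ p) := by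
  refine ⟨hasSum_sum hm, ?_⟩
  have h := hasSum_sum hμ
  refine h.congr_fun fun e => ?_
  rw [Finset.mul_sum]

end Summit.QuantumFields.BalabanUV.Beta.GAN24.SlotMomentParity

end
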